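import Literature.AnabelianGeometry.EtaleTheta.Discharge.Sec2KLConjugacyProofs
import Literature.AnabelianGeometry.EtaleTheta.Discharge.Sec2AutOverProofs

/-!
# [EtTh] Prop 2.14 (ii): when does a cocycle shift normalise `D_Y`? (generic `ThetaEnvData` lemmas)

Mochizuki, *The Étale Theta Function …* [EtTh], Publ. RIMS 45 (2009), §2, Def 2.13 (i) and
Prop 2.14 (ii), PRIMS PDF pp.47, 49 (locators `p.N` = PDF pages; bib key `MochizukiEtTh2009`).
PROOF-ONLY companion of `MonoThetaEnv.lean` (seat abc-iut-L2-t2); unit "deep EtTh:Prop2.14(ii)-model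
(hgal)" of seat abc-iut-L2-t10. Generic over the interface `T : ThetaEnvData N`:

* `shift_mem_contMulAut_of_continuous` — the shift by a continuous cocycle is bi-continuous;
* `exists_factor_of_apply_ker` — a cocycle of `Π^tp_Y` vanishing on `Ker(Π^tp_Y ↠ G_K)` is inflated
  from `G_K`;
* `DY_map_conj_shift_eq` — **the shift `α_ρ` normalises `D_Y`** as soon as, for every `y ∈ Π^tp_X`, the
  cocycle `(y·ρ)·ρ⁻¹` is inflated from `G_K` (proof of Prop 2.14 (ii), p.49: `α_ρ` commutes with the
  Kummer shifts and `α_ρ ∘ conj_z ∘ α_ρ⁻¹ = conj_z ∘ α_{(z⁻¹·ρ)·ρ⁻¹}`, "conjugation by `α_δ` preserves `D_Y`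
  [cf. the definition of `D_Y`!]").

The model-specific verification that `(y·ρ)·ρ⁻¹` IS inflated from `G_K` is
`Discharge/Sec2GalExtensionProofs.lean`. HONEST FRAMING: pure group theory over the interface; nothing
of [EtTh] is asserted; no side taken on [IUTchIII] Cor 3.12.
-/

noncomputable section

namespace Literature.AnabelianGeometry.EtaleTheta

universe u

namespace ThetaEnvData

variable {N : ℕ+} (T : ThetaEnvData.{u} N)

/-- The shift by a CONTINUOUS cocycle is an automorphism of the topological group `Π^tp_Y[μ_N]`.
[cite: MochizukiEtTh2009, Prop 2.14(ii) p.49] -/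
theorem shift_mem_contMulAut_of_continuous {δ : T.PiY → T.mu}
    (hδ : CycEnvelope.IsEnvCocycle T.augY T.chi δ) (hc : Continuous δ) :
    CycEnvelope.shift hδ ∈ contMulAut T.env := by
  refine ⟨?_, ?_⟩
  · change Continuous fun x : T.env => (⟨x.left * δ x.right, x.right⟩ : T.env)
    exact T.continuous_env_mk (T.continuous_left.mul (hc.comp T.continuous_right)) T.continuous_right
  · change Continuous fun x : T.env => (⟨x.left * (δ x.right)⁻¹, x.right⟩ : T.env)
    exact T.continuous_env_mk (T.continuous_left.mul (hc.comp T.continuous_right).inv)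
      T.continuous_right

/-- `(conjX z)⁻¹ = conjX z⁻¹`. [cite: MochizukiEtTh2009, Def 2.13(i) p.47] -/
theorem conjX_inv (z : T.PiX) : (T.conjX z)⁻¹ = T.conjX z⁻¹ := T.conjX_symm z

/-- A cocycle of `Π^tp_Y` for the cyclotomic character that vanishes on `Ker(Π^tp_Y → G_K)` is INFLATED
from `G_K` (it is constant on the fibres of `Π^tp_Y ↠ G_K`). [cite: MochizukiEtTh2009, Def 2.13(i) p.47] -/
theorem exists_factor_of_apply_ker (hsurj : Function.Surjective T.augY) {Φ : T.PiY → T.mu}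
    (hΦ : CycEnvelope.IsEnvCocycle T.augY T.chi Φ) (hker : ∀ d : T.PiY, T.augY d = 1 → Φ d = 1) :
    ∃ δ : T.G → T.mu, Φ = δ ∘ T.augY := by
  choose s hs using hsurj
  refine ⟨fun γ => Φ (s γ), funext fun g => ?_⟩
  have hd : T.augY ((s (T.augY g))⁻¹ * g) = 1 := by rw [map_mul, map_inv, hs, inv_mul_cancel]
  have : g = s (T.augY g) * ((s (T.augY g))⁻¹ * g) := by group
  conv_lhs => rw [this]
  rw [hΦ, hker _ hd, map_one, mul_one]
  rfl

/-- The conjugate `α_ρ ∘ conj_z ∘ α_ρ⁻¹` of a `Gal(Y/X)`-generator of `D_Y` by the shift `α_ρ` equals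
`conj_z ∘ α_{(z⁻¹·ρ)·ρ⁻¹}`; if the cocycle `(z⁻¹·ρ)·ρ⁻¹` is inflated from `G_K`, the conjugate lies in
`D_Y` (proof of Prop 2.14 (ii), p.49: "conjugation by `α_δ` preserves `D_Y` [cf. the definition of
`D_Y`!]"). [cite: MochizukiEtTh2009, Prop 2.14(ii) p.49] -/
theorem conj_galOut_mem_DY {ρ : T.PiY → T.mu} (hρ : CycEnvelope.IsEnvCocycle T.augY T.chi ρ)
    (hc : CycEnvelope.shift hρ ∈ contMulAut T.env)
    (hinv : ∀ y : T.PiX, ∃ δ : T.G → T.mu,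
      (fun g : T.PiY => T.chi (T.aug y) (ρ ⟨y⁻¹ * g * y, by
          simpa [mul_assoc] using T.PiY_normal.conj_mem _ g.2 y⁻¹⟩)) * ρ⁻¹ = δ ∘ T.augY)
    (z : T.PiX) (hcz : T.conjX z ∈ contMulAut T.env) :
    TopOut.mk _ ⟨_, hc⟩ * TopOut.mk _ ⟨_, hcz⟩ * (TopOut.mk _ ⟨_, hc⟩)⁻¹ ∈ T.DY := by
  obtain ⟨δ, hδ⟩ := hinv z⁻¹
  have hρz := T.isEnvCocycle_conjX z⁻¹ hρ
  -- the cocycle `(z⁻¹·ρ)·ρ⁻¹ = δ ∘ aug`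
  have hprod : CycEnvelope.IsEnvCocycle T.augY T.chi (δ ∘ T.augY) := by
    rw [← hδ]; exact hρz.mul hρ.inv
  have hshift : CycEnvelope.shift hρ * T.conjX z * (CycEnvelope.shift hρ)⁻¹ =
      T.conjX z * CycEnvelope.shift hprod := by
    have h1 : CycEnvelope.shift hρz = (T.conjX z)⁻¹ * CycEnvelope.shift hρ * T.conjX z := by
      rw [T.shift_conjX z⁻¹ hρ, ← T.conjX_inv, inv_inv]
    have h2 : CycEnvelope.shift hprod = CycEnvelope.shift hρz * CycEnvelope.shift hρ.inv := by
      rw [← CycEnvelope.shift_mul]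
      exact CycEnvelope.shift_congr _ _ hδ.symm
    rw [h2, h1, CycEnvelope.shift_inv]
    group
  have hcδ : CycEnvelope.shift hprod ∈ contMulAut T.env := by
    have : CycEnvelope.shift hprod = (T.conjX z)⁻¹ * (CycEnvelope.shift hρ * T.conjX z *
        (CycEnvelope.shift hρ)⁻¹) := by rw [hshift]; group
    rw [this]
    exact mul_mem (inv_mem hcz) (mul_mem (mul_mem hc hcz) (inv_mem hc))
  have hsub : ((⟨_, hc⟩ * ⟨_, hcz⟩ * ⟨_, hc⟩⁻¹ : contMulAut T.env)) = ⟨_, hcz⟩ * ⟨_, hcδ⟩ :=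
    Subtype.ext hshift
  have heq : TopOut.mk _ ⟨_, hc⟩ * TopOut.mk _ ⟨_, hcz⟩ * (TopOut.mk _ ⟨_, hc⟩)⁻¹ =
      TopOut.mk _ ⟨_, hcz⟩ * TopOut.mk T.env ⟨_, hcδ⟩ := by
    rw [← map_mul, ← map_inv, ← map_mul, hsub, map_mul]
  rw [heq]
  exact mul_mem (Subgroup.subset_closure (Or.inr ⟨z, hcz, rfl⟩))
    (Subgroup.subset_closure (Or.inl ⟨δ, hprod, hcδ, rfl⟩))

/-- The hypothesis of `conj_galOut_mem_DY` passes to the inverse cocycle.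
[cite: MochizukiEtTh2009, Prop 2.14(ii) p.49] -/
theorem hinv_inv {ρ : T.PiY → T.mu}
    (hinv : ∀ y : T.PiX, ∃ δ : T.G → T.mu,
      (fun g : T.PiY => T.chi (T.aug y) (ρ ⟨y⁻¹ * g * y, by
          simpa [mul_assoc] using T.PiY_normal.conj_mem _ g.2 y⁻¹⟩)) * ρ⁻¹ = δ ∘ T.augY)
    (y : T.PiX) : ∃ δ : T.G → T.mu,
      (fun g : T.PiY => T.chi (T.aug y) (ρ⁻¹ ⟨y⁻¹ * g * y, by
          simpa [mul_assoc] using T.PiY_normal.conj_mem _ g.2 y⁻¹⟩)) * ρ⁻¹⁻¹ = δ ∘ T.augY := by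
  obtain ⟨δ, hδ⟩ := hinv y
  refine ⟨δ⁻¹, funext fun g => ?_⟩
  have := congrFun hδ g
  simp only [Pi.mul_apply, Pi.inv_apply, Function.comp_apply] at this ⊢
  rw [← this, mul_inv, map_inv]

/-- **The shift by `ρ` normalises `D_Y`** as soon as `α_ρ` is bi-continuous and, for every `y ∈ Π^tp_X`,
the cocycle `(y·ρ)·ρ⁻¹` is inflated from `G_K`: `α_ρ` commutes with the Kummer shifts and conjugates each
`Gal(Y/X)`-generator into `D_Y` (`conj_galOut_mem_DY`). [cite: MochizukiEtTh2009, Prop 2.14(ii) p.49] -/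
theorem DY_map_conj_shift_eq {ρ : T.PiY → T.mu} (hρ : CycEnvelope.IsEnvCocycle T.augY T.chi ρ)
    (hc : CycEnvelope.shift hρ ∈ contMulAut T.env)
    (hinv : ∀ y : T.PiX, ∃ δ : T.G → T.mu,
      (fun g : T.PiY => T.chi (T.aug y) (ρ ⟨y⁻¹ * g * y, by
          simpa [mul_assoc] using T.PiY_normal.conj_mem _ g.2 y⁻¹⟩)) * ρ⁻¹ = δ ∘ T.augY) :
    T.DY.map (MulAut.conj (TopOut.mk _ ⟨_, hc⟩)).toMonoidHom = T.DY := by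
  have hc' : CycEnvelope.shift hρ.inv ∈ contMulAut T.env :=
    (CycEnvelope.shift_inv hρ) ▸ inv_mem hc
  have hinv' := T.hinv_inv hinv
  have hmk : (TopOut.mk _ ⟨_, hc⟩)⁻¹ = TopOut.mk T.env ⟨_, hc'⟩ := by
    rw [← map_inv]; congr 1; exact Subtype.ext (CycEnvelope.shift_inv hρ)
  refine T.DY_map_conj_eq_of_generators ⟨_, hc⟩ ?_ ?_
  · rintro d (⟨δ', hδ', hcδ', rfl⟩ | ⟨z, hcz, rfl⟩)
    · have : TopOut.mk _ ⟨_, hc⟩ * TopOut.mk _ ⟨_, hcδ'⟩ * (TopOut.mk _ ⟨_, hc⟩)⁻¹ =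
          TopOut.mk T.env ⟨_, hcδ'⟩ := by
        rw [← map_mul, ← map_inv, ← map_mul]
        congr 1
        apply Subtype.ext
        change CycEnvelope.shift hρ * CycEnvelope.shift hδ' * (CycEnvelope.shift hρ)⁻¹ = _
        rw [CycEnvelope.shift_comm, mul_inv_cancel_right]
      rw [this]
      exact Subgroup.subset_closure (Or.inl ⟨δ', hδ', hcδ', rfl⟩)
    · exact T.conj_galOut_mem_DY hρ hc hinv z hcz
  · rintro d (⟨δ', hδ', hcδ', rfl⟩ | ⟨z, hcz, rfl⟩)
    · have : (TopOut.mk _ ⟨_, hc⟩)⁻¹ * TopOut.mk _ ⟨_, hcδ'⟩ * TopOut.mk _ ⟨_, hc⟩ =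
          TopOut.mk T.env ⟨_, hcδ'⟩ := by
        rw [← map_inv, ← map_mul, ← map_mul]
        congr 1
        apply Subtype.ext
        change (CycEnvelope.shift hρ)⁻¹ * CycEnvelope.shift hδ' * CycEnvelope.shift hρ = _
        rw [mul_assoc, CycEnvelope.shift_comm hδ' hρ, inv_mul_cancel_left]
      rw [this]
      exact Subgroup.subset_closure (Or.inl ⟨δ', hδ', hcδ', rfl⟩)
    · have := T.conj_galOut_mem_DY hρ.inv hc' hinv' z hcz
      rw [← hmk, inv_inv] at this
      exact this

end ThetaEnvData

end Literature.AnabelianGeometry.EtaleTheta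

end
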